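import Mathlib
import Summits.RiemannHypothesis.RiemannHypothesis.Theorems.PfPersistenceAdmissibleClass
import Summits.RiemannHypothesis.RiemannHypothesis.Theorems.PfPersistencePolarCalculus

/-!
# PF persistence — the polar block is RANK ONE, in closed form (pub-rhpf, pf seat; adjudication A8)

**HONEST FRAMING. Long-odds MECHANISM SEARCH; no RH claims.** Nothing here is, or is conditional progress
toward, the Riemann Hypothesis. This file discharges the identification hypothesis flagged by the cell's
adjudicator (A8: "the per-`(a, N)` identification `Galerkin Q = A₀ + 2|c⟩⟨c|` must be a stated hypothesis or a
short lemma") as a **PROVED** lemma about the barrier-typer's objects in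
`Theorems/PfPersistenceAdmissibleClass.lean`:

* `W02_thetaEven` : for every real `L` and all `n m : ℕ`,
  `W02 L (thetaEven L n m) = polarScale L * polarGen L n * polarGen L m`, where
  `polarScale L = 2 (cosh(L/2) − 1) / L`, `polarGen L 0 = 2√2` and
  `polarGen L n = 1 / (1/4 + (2πn/L)²)` for `n ≥ 1` (elementary calculus: explicit antiderivatives of
  `sin(ky) cosh(y/2)`, `cos(ky) cosh(y/2)`, `y cos(ky) cosh(y/2)`, `(L−y)/L · cosh(y/2)` and `kL ∈ 2πℕ`, in the helper file `PfPersistencePolarCalculus.lean`);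
* `polarBlock_eq_smul_vecMulVec` : `polarBlock win = polarScale (2a) • vecMulVec g g` with
  `g n = polarGen (2a) n` — the polar block of the even Galerkin matrix is a scalar multiple of a rank-one
  projector-type matrix (`PROVED`, RH-free, no hypothesis on the window);
* `evenBlock_eq_rankOne_sub` : `evenBlock w win = polarScale (2a) • vecMulVec g g − (archBlock win + primesBlock w win)`,
  i.e. the even block is `A + (rank one)` with `A = −(archBlock + primesBlock)` — the shape `A₀ + 2|c⟩⟨c|`
  assumed (with `A₀`, `c` as parameters) in `EvenSectorBartaEvenOneSignedWindowsAMPMargin.lean`,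
  `…AntiMaximum.lean` and `Literature/Analysis/InnerProduct/RankOne*.lean`.

Informal source of the identity: for a test function `f` on `[0, L]` symmetric about `L/2` the polar term of
Weil's functional is `2 ∫f e^{x/2} · ∫f e^{−x/2} = 2e^{−L/2} (∫₀ᴸ f e^{x/2})²` (Bombieri, *Remarks on Weil's
quadratic functional*, 2000, §2; Connes–Consani arXiv:2106.01715 Lemma 2.6 for the basis `θ_{ξ_n, ξ_m}`); here it
is simply computed entry by entry. Labels: **PROVED** = kernel-checked below; nothing is DATA.
-/

set_option linter.dupNamespace false  -- the mandated namespace repeats `RiemannHypothesis`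

noncomputable section

open Real intervalIntegral

namespace Summit.RiemannHypothesis.RiemannHypothesis.Theorems.PfPersistence

namespace PolarRankOne

/-! ## The five cases of `W02 (thetaEven L n m)` -/

/-- PROVED: case `n = m = 0`: `W02 = 16 (cosh(L/2) − 1)/L`. [folklore] -/
theorem W02_zero_zero (L : ℝ) : W02 L (thetaEven L 0 0) = 16 * (Real.cosh (L / 2) - 1) / L := by
  have h1 : ∀ y, thetaEven L 0 0 y * Real.cosh (y / 2) = (L - y) / L * Real.cosh (y / 2) := fun y => by
    simp [thetaEven]
  unfold W02
  simp_rw [h1, integral_Fa]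
  ring

/-- PROVED: the sine case: `4 ∫₀ᴸ (−sin(2πmy/L)/(√2 π m)) cosh(y/2) dy = 4√2 (cosh(L/2) − 1)/(L D_m)` for `m ≠ 0`.
[folklore] -/
theorem W02_sine (L : ℝ) (m : ℕ) (hm : m ≠ 0) :
    4 * ∫ y in (0:ℝ)..L, -Real.sin (2 * π * m * y / L) / (Real.sqrt 2 * π * m) * Real.cosh (y / 2) =
      4 * Real.sqrt 2 * (Real.cosh (L / 2) - 1) / (L * Dk (2 * π * m / L)) := by
  have hm' : (m : ℝ) ≠ 0 := Nat.cast_ne_zero.mpr hm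
  have hπ : (π : ℝ) ≠ 0 := Real.pi_ne_zero
  have h2 : Real.sqrt 2 ≠ 0 := by positivity
  have hsq : Real.sqrt 2 * Real.sqrt 2 = 2 := Real.mul_self_sqrt (by norm_num)
  have hD := (Dk_pos (2 * π * m / L)).ne'
  have h1 : ∀ y, -Real.sin (2 * π * m * y / L) / (Real.sqrt 2 * π * m) * Real.cosh (y / 2) =
      -(1 / (Real.sqrt 2 * π * m)) * (Real.sin (2 * π * m / L * y) * Real.cosh (y / 2)) := fun y => by
    rw [show 2 * π * (m : ℝ) * y / L = 2 * π * m / L * y by ring]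
    ring
  simp_rw [h1, intervalIntegral.integral_const_mul,
    integral_sin_cosh _ _ (sin_kL m L) (cos_kL m L)]
  have key : (4 : ℝ) * Real.sqrt 2 = 8 / Real.sqrt 2 := by
    rw [eq_div_iff h2]; nlinarith [hsq]
  rw [key]
  generalize Dk (2 * π * m / L) = D at hD ⊢
  rcases eq_or_ne L 0 with hL | hL
  · subst hL; simp
  · field_simp
    ring

/-- PROVED: case `n = 0`, `m ≠ 0`. [folklore] -/
theorem W02_zero_ne (L : ℝ) (m : ℕ) (hm : m ≠ 0) :
    W02 L (thetaEven L 0 m) = 4 * Real.sqrt 2 * (Real.cosh (L / 2) - 1) / (L * Dk (2 * π * m / L)) := by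
  have h1 : ∀ y, thetaEven L 0 m y = -Real.sin (2 * π * m * y / L) / (Real.sqrt 2 * π * m) := fun y => by
    simp [thetaEven, hm]
  unfold W02
  simp_rw [h1]
  exact W02_sine L m hm

/-- PROVED: case `n ≠ 0`, `m = 0`. [folklore] -/
theorem W02_ne_zero (L : ℝ) (n : ℕ) (hn : n ≠ 0) :
    W02 L (thetaEven L n 0) = 4 * Real.sqrt 2 * (Real.cosh (L / 2) - 1) / (L * Dk (2 * π * n / L)) := by
  have h1 : ∀ y, thetaEven L n 0 y = -Real.sin (2 * π * n * y / L) / (Real.sqrt 2 * π * n) := fun y => by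
    simp [thetaEven, hn]
  unfold W02
  simp_rw [h1]
  exact W02_sine L n hn

/-- PROVED: case `n = m ≠ 0`: `W02 = 2 (cosh(L/2) − 1)/(L D_n²)`. [folklore] -/
theorem W02_diag (L : ℝ) (n : ℕ) (hn : n ≠ 0) :
    W02 L (thetaEven L n n) = 2 * (Real.cosh (L / 2) - 1) / (L * Dk (2 * π * n / L) ^ 2) := by
  have hn' : (n : ℝ) ≠ 0 := Nat.cast_ne_zero.mpr hn
  have hπ : (π : ℝ) ≠ 0 := Real.pi_ne_zero
  have hD := (Dk_pos (2 * π * n / L)).ne'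
  rcases eq_or_ne L 0 with hL | hL
  · subst hL; simp [W02]
  set k : ℝ := 2 * π * n / L with hk
  have h1 : ∀ y, thetaEven L n n y * Real.cosh (y / 2) =
      Real.cos (k * y) * Real.cosh (y / 2) - 1 / L * (y * (Real.cos (k * y) * Real.cosh (y / 2))) -
        1 / (2 * π * n) * (Real.sin (k * y) * Real.cosh (y / 2)) := fun y => by
    simp only [thetaEven, hn, and_self, if_false, if_true]
    rw [show 2 * π * (n : ℝ) * y / L = k * y by rw [hk]; ring]
    field_simp
  have hi1 : IntervalIntegrable (fun y : ℝ => Real.cos (k * y) * Real.cosh (y / 2)) MeasureTheory.volume 0 L :=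
    (by fun_prop : Continuous fun y : ℝ => Real.cos (k * y) * Real.cosh (y / 2)).intervalIntegrable _ _
  have hi2 : IntervalIntegrable (fun y : ℝ => 1 / L * (y * (Real.cos (k * y) * Real.cosh (y / 2))))
      MeasureTheory.volume 0 L :=
    (by fun_prop : Continuous fun y : ℝ => 1 / L * (y * (Real.cos (k * y) * Real.cosh (y / 2)))).intervalIntegrable _ _
  have hi3 : IntervalIntegrable (fun y : ℝ => 1 / (2 * π * n) * (Real.sin (k * y) * Real.cosh (y / 2)))
      MeasureTheory.volume 0 L :=
    (by fun_prop : Continuous fun y : ℝ =>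
      1 / (2 * π * n) * (Real.sin (k * y) * Real.cosh (y / 2))).intervalIntegrable _ _
  have hs : Real.sin (k * L) = 0 := sin_kL n L
  have hc : Real.cos (k * L) = 1 := cos_kL n L
  unfold W02
  simp_rw [h1]
  rw [intervalIntegral.integral_sub (hi1.sub hi2) hi3, intervalIntegral.integral_sub hi1 hi2,
    intervalIntegral.integral_const_mul, intervalIntegral.integral_const_mul,
    integral_cos_cosh k L hs hc, integral_mul_cos_cosh k L hs hc, integral_sin_cosh k L hs hc]
  rw [hk]
  unfold Dk at hD ⊢
  field_simp
  ring

/-- PROVED: case `n ≠ m`, both nonzero: `W02 = 2 (cosh(L/2) − 1)/(L D_n D_m)`. [folklore] -/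
theorem W02_offdiag (L : ℝ) (n m : ℕ) (hn : n ≠ 0) (hm : m ≠ 0) (hnm : n ≠ m) :
    W02 L (thetaEven L n m) =
      2 * (Real.cosh (L / 2) - 1) / (L * (Dk (2 * π * n / L) * Dk (2 * π * m / L))) := by
  have hn' : (n : ℝ) ≠ 0 := Nat.cast_ne_zero.mpr hn
  have hm' : (m : ℝ) ≠ 0 := Nat.cast_ne_zero.mpr hm
  have hπ : (π : ℝ) ≠ 0 := Real.pi_ne_zero
  have hΔ : ((m : ℝ) ^ 2 - (n : ℝ) ^ 2) ≠ 0 := by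
    intro h
    have h' : ((m : ℝ) - n) * ((m : ℝ) + n) = 0 := by ring_nf; linarith [h]
    rcases mul_eq_zero.mp h' with h1 | h1
    · exact hnm (by exact_mod_cast (sub_eq_zero.mp h1).symm)
    · have : (0 : ℝ) < (m : ℝ) + n := by positivity
      linarith
  have hDn := (Dk_pos (2 * π * n / L)).ne'
  have hDm := (Dk_pos (2 * π * m / L)).ne'
  rcases eq_or_ne L 0 with hL | hL
  · subst hL; simp [W02]
  set kn : ℝ := 2 * π * n / L with hkn
  set km : ℝ := 2 * π * m / L with hkm
  have h1 : ∀ y, thetaEven L n m y * Real.cosh (y / 2) =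
      (n : ℝ) / (π * ((m : ℝ) ^ 2 - (n : ℝ) ^ 2)) * (Real.sin (kn * y) * Real.cosh (y / 2)) -
        (m : ℝ) / (π * ((m : ℝ) ^ 2 - (n : ℝ) ^ 2)) * (Real.sin (km * y) * Real.cosh (y / 2)) := fun y => by
    simp only [thetaEven, hn, hm, hnm, and_self, if_false]
    rw [show 2 * π * (n : ℝ) * y / L = kn * y by rw [hkn]; ring,
      show 2 * π * (m : ℝ) * y / L = km * y by rw [hkm]; ring]
    field_simp
  have hi1 : IntervalIntegrable
      (fun y : ℝ => (n : ℝ) / (π * ((m : ℝ) ^ 2 - (n : ℝ) ^ 2)) * (Real.sin (kn * y) * Real.cosh (y / 2)))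
      MeasureTheory.volume 0 L :=
    (by fun_prop : Continuous fun y : ℝ =>
      (n : ℝ) / (π * ((m : ℝ) ^ 2 - (n : ℝ) ^ 2)) * (Real.sin (kn * y) * Real.cosh (y / 2))).intervalIntegrable _ _
  have hi2 : IntervalIntegrable
      (fun y : ℝ => (m : ℝ) / (π * ((m : ℝ) ^ 2 - (n : ℝ) ^ 2)) * (Real.sin (km * y) * Real.cosh (y / 2)))
      MeasureTheory.volume 0 L :=
    (by fun_prop : Continuous fun y : ℝ =>
      (m : ℝ) / (π * ((m : ℝ) ^ 2 - (n : ℝ) ^ 2)) * (Real.sin (km * y) * Real.cosh (y / 2))).intervalIntegrable _ _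
  unfold W02
  simp_rw [h1]
  rw [intervalIntegral.integral_sub hi1 hi2, intervalIntegral.integral_const_mul,
    intervalIntegral.integral_const_mul, integral_sin_cosh kn L (sin_kL n L) (cos_kL n L),
    integral_sin_cosh km L (sin_kL m L) (cos_kL m L)]
  rw [hkn, hkm]
  unfold Dk at hDn hDm ⊢
  field_simp
  ring

end PolarRankOne

open PolarRankOne

/-! ## The rank-one identity -/

/-- The scalar `ρ(L) = 2 (cosh(L/2) − 1)/L` of the polar block (`L = 2a`). [folklore] -/
def polarScale (L : ℝ) : ℝ := 2 * (Real.cosh (L / 2) - 1) / L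

/-- The generating vector of the polar block: `g₀ = 2√2`, `g_n = 1/(1/4 + (2πn/L)²)` (`n ≥ 1`); up to the
factor `√(ρ/2)` these are the moments `⟨ξ_n, e^{x/2}⟩` of the cosine basis. [folklore] -/
def polarGen (L : ℝ) (n : ℕ) : ℝ := if n = 0 then 2 * Real.sqrt 2 else 1 / Dk (2 * π * n / L)

/-- PROVED (closed form, all cases): `W02 L (θ_{nm}) = ρ(L) g_n g_m`. [folklore] -/
theorem W02_thetaEven (L : ℝ) (n m : ℕ) :
    W02 L (thetaEven L n m) = polarScale L * polarGen L n * polarGen L m := by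
  have h8 : Real.sqrt 2 ^ 2 = 2 := Real.sq_sqrt (by norm_num)
  rcases eq_or_ne n 0 with hn | hn <;> rcases eq_or_ne m 0 with hm | hm
  · subst hn; subst hm
    rw [W02_zero_zero]
    simp only [polarScale, polarGen, if_true]
    rcases eq_or_ne L 0 with hL | hL
    · subst hL; simp
    · field_simp
      linear_combination (-(2 ^ 3) * (Real.cosh (L / 2) - 1)) * h8
  · subst hn
    have hD := (Dk_pos (2 * π * m / L)).ne'
    rw [W02_zero_ne L m hm]
    simp only [polarScale, polarGen, hm, if_true, if_false]
    generalize Dk (2 * π * m / L) = D at hD ⊢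
    rcases eq_or_ne L 0 with hL | hL
    · subst hL; simp
    · field_simp
      ring
  · subst hm
    have hD := (Dk_pos (2 * π * n / L)).ne'
    rw [W02_ne_zero L n hn]
    simp only [polarScale, polarGen, hn, if_true, if_false]
    generalize Dk (2 * π * n / L) = D at hD ⊢
    rcases eq_or_ne L 0 with hL | hL
    · subst hL; simp
    · field_simp
      ring
  · rcases eq_or_ne n m with hnm | hnm
    · subst hnm
      have hD := (Dk_pos (2 * π * n / L)).ne'
      rw [W02_diag L n hn]
      simp only [polarScale, polarGen, hn, if_false]
      generalize Dk (2 * π * n / L) = D at hD ⊢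
      rcases eq_or_ne L 0 with hL | hL
      · subst hL; simp
      · field_simp
    · have hDn := (Dk_pos (2 * π * n / L)).ne'
      have hDm := (Dk_pos (2 * π * m / L)).ne'
      rw [W02_offdiag L n m hn hm hnm]
      simp only [polarScale, polarGen, hn, hm, if_false]
      generalize Dk (2 * π * n / L) = D at hDn ⊢
      generalize Dk (2 * π * m / L) = D' at hDm ⊢
      rcases eq_or_ne L 0 with hL | hL
      · subst hL; simp
      · field_simp

/-- PROVED (A8 discharged): the polar block is a scalar multiple of a rank-one matrix,
`polarBlock win = ρ(2a) • g gᵀ`. [folklore] -/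
theorem polarBlock_eq_smul_vecMulVec (win : Window) :
    polarBlock win = polarScale (2 * win.a) •
      Matrix.vecMulVec (fun n : Fin (win.N + 1) => polarGen (2 * win.a) n)
        (fun m : Fin (win.N + 1) => polarGen (2 * win.a) m) := by
  ext n m
  simp [polarBlock, Matrix.vecMulVec, Matrix.smul_apply, W02_thetaEven, mul_assoc]

/-- PROVED: the even Galerkin block is `(rank one) − (archBlock + primesBlock)`, i.e. of the shape
`A₀ + 2|c⟩⟨c|` with `A₀ = −(archBlock + primesBlock)` used as a hypothesis elsewhere in the cell. [folklore] -/
theorem evenBlock_eq_rankOne_sub (w : Weights) (win : Window) :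
    evenBlock w win = polarScale (2 * win.a) •
      Matrix.vecMulVec (fun n : Fin (win.N + 1) => polarGen (2 * win.a) n)
        (fun m : Fin (win.N + 1) => polarGen (2 * win.a) m) - (archBlock win + primesBlock w win) := by
  rw [evenBlock_eq_decomp, polarBlock_eq_smul_vecMulVec, sub_sub]

/-- PROVED: `ρ(2a) = (cosh a − 1)/a`; in particular `ρ(2a) > 0` for `a > 0` (so `ρ • g gᵀ = 2|c⟩⟨c|` with the real
vector `c = √(ρ/2) g`). [folklore] -/
theorem polarScale_two_mul (a : ℝ) : polarScale (2 * a) = (Real.cosh a - 1) / a := by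
  unfold polarScale
  rw [show 2 * a / 2 = a by ring]
  rcases eq_or_ne a 0 with h | h
  · subst h; simp
  · field_simp

/-- PROVED: `ρ(2a) > 0` for `0 < a`. [folklore] -/
theorem polarScale_two_mul_pos {a : ℝ} (ha : 0 < a) : 0 < polarScale (2 * a) := by
  rw [polarScale_two_mul]
  have : 1 < Real.cosh a := Real.one_lt_cosh.mpr ha.ne'
  exact div_pos (by linarith) ha

/-- The POLAR VECTOR `c` of a (genuine, `0 < a`) window: `c_n = √(ρ(2a)/2) · g_n`, so that the polar block is
`2|c⟩⟨c|`. [folklore] -/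
def polarVec (win : Window) (n : Fin (win.N + 1)) : ℝ :=
  Real.sqrt (polarScale (2 * win.a) / 2) * polarGen (2 * win.a) n

/-- PROVED (the `2|c⟩⟨c|` normal form used cell-wide, A8): `polarBlock win = 2 • c cᵀ` with the real vector
`c = polarVec win` (uses the window guard `0 < a` of `Window`). [folklore] -/
theorem polarBlock_eq_two_smul_vecMulVec (win : Window) :
    polarBlock win = (2 : ℝ) • Matrix.vecMulVec (polarVec win) (polarVec win) := by
  have hρ : 0 ≤ polarScale (2 * win.a) / 2 :=
    (div_pos (polarScale_two_mul_pos win.ha) two_pos).le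
  have hs : Real.sqrt (polarScale (2 * win.a) / 2) * Real.sqrt (polarScale (2 * win.a) / 2) =
      polarScale (2 * win.a) / 2 := Real.mul_self_sqrt hρ
  have key : ∀ x y : ℝ, (2 : ℝ) * (Real.sqrt (polarScale (2 * win.a) / 2) * x *
      (Real.sqrt (polarScale (2 * win.a) / 2) * y)) = polarScale (2 * win.a) * (x * y) := fun x y => by
    have h' : (2 : ℝ) * (Real.sqrt (polarScale (2 * win.a) / 2) * x * (Real.sqrt (polarScale (2 * win.a) / 2) * y)) =
        2 * (Real.sqrt (polarScale (2 * win.a) / 2) * Real.sqrt (polarScale (2 * win.a) / 2)) * (x * y) := by ring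
    rw [h', hs]; ring
  rw [polarBlock_eq_smul_vecMulVec]
  ext n m
  simp only [Matrix.smul_apply, Matrix.vecMulVec_apply, polarVec, smul_eq_mul]
  exact (key _ _).symm

/-- PROVED: `Q = A₀ + 2|c⟩⟨c|` literally — `evenBlock w win = −(archBlock win + primesBlock w win) + 2 • c cᵀ`. [folklore] -/
theorem evenBlock_eq_poleFree_add_two_smul (w : Weights) (win : Window) :
    evenBlock w win = -(archBlock win + primesBlock w win) +
      (2 : ℝ) • Matrix.vecMulVec (polarVec win) (polarVec win) := by
  rw [evenBlock_eq_decomp, polarBlock_eq_two_smul_vecMulVec]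
  abel

end Summit.RiemannHypothesis.RiemannHypothesis.Theorems.PfPersistence

end
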